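import Summits.QuantumFields.YangMills.Theorems.FluctuationComparisonRegPrIntLS2BetaCriticalOrbitUnique
import HarnessLib

/-!
# S2β · PROP. 7 CLAUSE 1 FROM ONE E–L-CRITICAL REGULAR POINT WHOSE DATUM-SYMMETRIES LIFT — the E–L re-cut of ✓pen 4 and the transport of the lifting property

Cell `ym3-torus` (rung R3 = SU(2) YM₃ on T³ — NOT d = 4, NOT infinite volume, NOT a mass gap, NOT Clay).  Width seat `ym3-torus-px17` (gen 15), pen 7; FREE px helper of
`stmt-QuantumFields-20520` (`--supports … --as helper`, count-neutral); DEFINITION-FREE (0 `def`∕`instance`∕`notation`∕`sorry`, default heartbeats).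

WHY.  ✓pen 4 `…S2BetaCriticalOrbitUnique` derives [Balaban1985Variational] Prop. 7 clause 1 from ✓pen 3's orbit growth at points critical IN READING R2 (`IsCritR2` —
minimisers over some regular fibre) and from the lifting of the datum's symmetries to a critical point.  px12 g21's abelian-stratum pen (B) (`…S2BetaAbelianSymmetricCriticality`)
produces instead a σ₃-diagonal regular point `W` that is E–L-CRITICAL along every bondwise-differentiable fibre curve (Palais' symmetric criticality for `c₀ = diag(i, −i)`) and whose
datum-symmetries lift; `W` need not be R2-critical.  THIS FILE is the generic, abelian-free half: pen 4 §2∕§3b re-cut to the E–L binder of ✓pen 3 `orbitGrowth_of_regular_five`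
(verbatim), and the transport of the lifting property along a gauge transformation whose descent stabilises the datum.

WHAT.
* §1 ★`symmetriesLift_gaugeAct` — transport: if `(u↓) • V = V` and every symmetry of `V` lifts to a symmetry of `W` with prescribed descent, the same holds at `u • W`
  (`s ↦ s′ := (u↓)⁻¹·s·(u↓)`, lift `k′` at `W`, `k := u·k′·u⁻¹`).
* §2 ★★`critical_gaugeRelated_of_el_five` — `L ≥ 5`, `0 < e ≤ e₈(L)`: two E–L-critical points of `regFibrePr F n K e V` are gauge-related, `W′ = u • W`, with `(u↓) • V = V`
  (✓`orbitGrowth_of_regular_five` both ways ⇒ equal actions ⇒ the orbit sum vanishes; pen 4 §2 with E–L in place of `IsCritR2` on both sides).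
* §3 ★★`sameOrbit_of_el_of_symmetriesLift_five` — if moreover `V`'s symmetries lift to `W`, then `SameOrbit W W′` (print's group (4): `w := u·k⁻¹`, `w↓ ≡ 1`).
* §4 ★★★`atMostOneCriticalOrbit_of_el_symmetriesLift_five` — `(varProblem3 F n K h).AtMostOneCriticalOrbit e V` as soon as SOME `W ∈ regFibrePr F n K e V` is E–L-critical with
  lifting symmetries (R2-critical points are E–L-critical: ✓`Prop7CritEL.deriv_comp_eq_zero_of_isCritR2`; §3 from `W` to each of them; ✓`sameOrbit_symm`∕`sameOrbit_trans`).
HONEST.  Composition ∕ group algebra over landed theorems ((142) with rate is ✓p796833∕✓p797047); the abelian existence letter EX^{ab} (px12's), reducible data in general, TUBE-REG∘,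
GAP♯∘, EXW∘, S2β, 20520, `YM3TorusSU2` NOT proved; the Yang–Mills mass gap is NOT proved.
References: T. Bałaban, CMP **102** (1985) 277–309 [Balaban1985Variational] (Prop. 7 p.299, (4)–(6) p.278, (141)–(143) p.299); CMP **98** (1985) 17–51 [Balaban1985Averaging]
((8), (11)–(13) p.19); R. S. Palais, CMP **69** (1979) 19–30 (symmetric criticality — motivation only, not used).
-/

set_option autoImplicit false
noncomputable section

open scoped BigOperators Matrix.Norms.L2Operator Matrix

namespace Summit.QuantumFields.YangMills.Theorems.FluctuationComparisonRegPrIntLS2BetaCriticalELRelated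

open Literature.MathematicalPhysics.QuantumFieldTheory.Balaban1983to89
open Literature.MathematicalPhysics.QuantumFieldTheory.Balaban1983to89.T3ContinuumYM3Torus
open Literature.MathematicalPhysics.QuantumFieldTheory.Balaban1983to89.T3UnitLawDensityEML (ℰp)
open Literature.MathematicalPhysics.QuantumFieldTheory.Balaban1983to89.T3ConstrainedMinimiser (fibre)
open Literature.MathematicalPhysics.QuantumFieldTheory.Balaban1983to89.T3PrintedRegularMinimiser
open Literature.MathematicalPhysics.QuantumFieldTheory.Balaban1983to89.T3PrintedRegularOrbits (descTransf)
open Literature.MathematicalPhysics.QuantumFieldTheory.Balaban1983to89.T3Thm1Carrier (SameOrbit varProblem3)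
open Literature.MathematicalPhysics.QuantumFieldTheory.Balaban1983to89.T3Thm1CarrierNative (IsCritR2)
open Literature.MathematicalPhysics.QuantumFieldTheory.Balaban1983to89.T3SectALandauChart (descTransf_mul descTransf_inv sameOrbit_symm sameOrbit_trans)
open Summit.QuantumFields.YangMills.Theorems.FluctuationComparisonRegPrIntLS2BetaOrbitGrowthOfRegular (orbitGrowth_of_regular_five)
open Summit.QuantumFields.YangMills.Theorems.FluctuationComparisonRegPrIntLS2BetaCriticalOrbitUnique
  (eq_of_sum_dist1_sq_eq_zero gaugeAct_descTransf_eq_of_mem_fibre descTransf_mul_inv)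
open Summit.QuantumFields.YangMills.Theorems.Prop7CritEL (deriv_comp_eq_zero_of_isCritR2 continuousAt_of_differentiableAt_bonds)

/-! ## §1 Transport of the lifting property along the orbit -/

section Transport

variable (F : T3Family) {n K : ℕ} (h : n ≤ K)

/-- ★ **TRANSPORT OF «THE DATUM's SYMMETRIES LIFT».**  If `(u↓) • V = V` and every gauge transformation `s` of the comparison lattice fixing `V` is the descent of some `k`
fixing `W`, then the same holds at `u • W`: for `s` fixing `V`, `s′ := (u↓)⁻¹·s·(u↓)` fixes `V`, lifts to `k′` at `W`, and `k := u·k′·u⁻¹` fixes `u • W` with `k↓ = s`.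
[cite: Balaban1985Variational, (4) p.278; Balaban1985Averaging, (11)-(13) p.19] -/
theorem symmetriesLift_gaugeAct {V : GaugeField (F.P n) 0 (Matrix.specialUnitaryGroup (Fin 2) ℂ)} {W : GaugeField (F.P K) 0 (Matrix.specialUnitaryGroup (Fin 2) ℂ)}
    (u : GaugeTransf (F.P K) 0 (Matrix.specialUnitaryGroup (Fin 2) ℂ)) (hfix : GaugeField.gaugeAct (descTransf F n K h u) V = V)
    (hlift : ∀ s : GaugeTransf (F.P n) 0 (Matrix.specialUnitaryGroup (Fin 2) ℂ), GaugeField.gaugeAct s V = V →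
      ∃ k : GaugeTransf (F.P K) 0 (Matrix.specialUnitaryGroup (Fin 2) ℂ), GaugeField.gaugeAct k W = W ∧ descTransf F n K h k = s) :
    ∀ s : GaugeTransf (F.P n) 0 (Matrix.specialUnitaryGroup (Fin 2) ℂ), GaugeField.gaugeAct s V = V →
      ∃ k : GaugeTransf (F.P K) 0 (Matrix.specialUnitaryGroup (Fin 2) ℂ),
        GaugeField.gaugeAct k (GaugeField.gaugeAct u W) = GaugeField.gaugeAct u W ∧ descTransf F n K h k = s := by
  intro s hs
  -- the conjugated symmetry `s′ := (u↓)⁻¹ · s · (u↓)` fixes `V`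
  have hs' : GaugeField.gaugeAct (fun y => (descTransf F n K h u y)⁻¹ * s y * descTransf F n K h u y) V = V := by
    funext b
    have h1 : descTransf F n K h u b.src * V b * (descTransf F n K h u b.tgt)⁻¹ = V b := congrFun hfix b
    have h2 : s b.src * V b * (s b.tgt)⁻¹ = V b := congrFun hs b
    show (descTransf F n K h u b.src)⁻¹ * s b.src * descTransf F n K h u b.src * V b *
        ((descTransf F n K h u b.tgt)⁻¹ * s b.tgt * descTransf F n K h u b.tgt)⁻¹ = V b
    calc (descTransf F n K h u b.src)⁻¹ * s b.src * descTransf F n K h u b.src * V b *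
          ((descTransf F n K h u b.tgt)⁻¹ * s b.tgt * descTransf F n K h u b.tgt)⁻¹
        = (descTransf F n K h u b.src)⁻¹ * s b.src * (descTransf F n K h u b.src * V b * (descTransf F n K h u b.tgt)⁻¹) *
            (s b.tgt)⁻¹ * descTransf F n K h u b.tgt := by group
      _ = (descTransf F n K h u b.src)⁻¹ * (s b.src * V b * (s b.tgt)⁻¹) * descTransf F n K h u b.tgt := by rw [h1]; group
      _ = (descTransf F n K h u b.src)⁻¹ * (descTransf F n K h u b.src * V b * (descTransf F n K h u b.tgt)⁻¹) *
            descTransf F n K h u b.tgt := by rw [h2, h1]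
      _ = V b := by group
  obtain ⟨k', hk'W, hk'⟩ := hlift _ hs'
  refine ⟨fun x => u x * k' x * (u x)⁻¹, ?_, ?_⟩
  · funext b
    have hkb : k' b.src * W b * (k' b.tgt)⁻¹ = W b := congrFun hk'W b
    show u b.src * k' b.src * (u b.src)⁻¹ * (u b.src * W b * (u b.tgt)⁻¹) * (u b.tgt * k' b.tgt * (u b.tgt)⁻¹)⁻¹ = u b.src * W b * (u b.tgt)⁻¹
    calc u b.src * k' b.src * (u b.src)⁻¹ * (u b.src * W b * (u b.tgt)⁻¹) * (u b.tgt * k' b.tgt * (u b.tgt)⁻¹)⁻¹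
        = u b.src * (k' b.src * W b * (k' b.tgt)⁻¹) * (u b.tgt)⁻¹ := by group
      _ = u b.src * W b * (u b.tgt)⁻¹ := by rw [hkb]
  · -- `(u·k′·u⁻¹)↓ = (u↓)·(k′↓)·(u↓)⁻¹ = (u↓)·s′·(u↓)⁻¹ = s`
    have e1 : descTransf F n K h (fun x => u x * k' x * (u x)⁻¹) =
        fun y => descTransf F n K h (fun x => u x * k' x) y * (descTransf F n K h u y)⁻¹ :=
      descTransf_mul_inv h (fun x => u x * k' x) u
    have e2 : descTransf F n K h (fun x => u x * k' x) = fun y => descTransf F n K h u y * descTransf F n K h k' y :=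
      descTransf_mul F h u k'
    rw [e1]
    funext y
    rw [e2, hk']
    show descTransf F n K h u y * ((descTransf F n K h u y)⁻¹ * s y * descTransf F n K h u y) * (descTransf F n K h u y)⁻¹ = s y
    group

end Transport

/-! ## §2 Two E–L-critical regular points are gauge-related (`L ≥ 5`, zero further hypotheses) -/

/-- ★★ **E–L EDITION OF ✓pen 4 §2.**  For every `L ≥ 5` there is `e₈ > 0` such that at every member `(F, n < K)`, datum `V`, `0 < e ≤ e₈`: two points `W, W′ ∈ regFibrePr F n K e V`,
each E–L-critical along every bondwise-differentiable fibre curve (✓pen 3's binder), satisfy `W′ = u • W` with `(u↓) • V = V`.  ✓`orbitGrowth_of_regular_five` both ways ⇒ equal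
actions ⇒ zero orbit sum ⇒ ✓`eq_of_sum_dist1_sq_eq_zero`, ✓`gaugeAct_descTransf_eq_of_mem_fibre`. [cite: Balaban1985Variational, Prop. 7 p.299, (141)-(143) p.299, (4)-(6) p.278] -/
theorem critical_gaugeRelated_of_el_five (L : ℕ) (h5 : 5 ≤ L) :
    ∃ e₈ : ℝ, 0 < e₈ ∧
      ∀ (F : T3Family), F.L = L → ∀ (n K : ℕ) (hnK : n < K) (e : ℝ) (V : GaugeField (F.P n) 0 (Matrix.specialUnitaryGroup (Fin 2) ℂ))
        (W W' : GaugeField (F.P K) 0 (Matrix.specialUnitaryGroup (Fin 2) ℂ)),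
        0 < e → e ≤ e₈ → W ∈ regFibrePr F n K hnK.le e V →
        (∀ γ : ℝ → GaugeField (F.P K) 0 (Matrix.specialUnitaryGroup (Fin 2) ℂ), γ 0 = W → (∀ t, γ t ∈ fibre F ℰp n K hnK.le V) →
          (∀ b, DifferentiableAt ℝ (fun t => ((γ t b : Matrix.specialUnitaryGroup (Fin 2) ℂ) : Matrix (Fin 2) (Fin 2) ℂ)) 0) →
            deriv (fun t => wilsonAction4 (γ t)) 0 = 0) →
        W' ∈ regFibrePr F n K hnK.le e V →
        (∀ γ : ℝ → GaugeField (F.P K) 0 (Matrix.specialUnitaryGroup (Fin 2) ℂ), γ 0 = W' → (∀ t, γ t ∈ fibre F ℰp n K hnK.le V) →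
          (∀ b, DifferentiableAt ℝ (fun t => ((γ t b : Matrix.specialUnitaryGroup (Fin 2) ℂ) : Matrix (Fin 2) (Fin 2) ℂ)) 0) →
            deriv (fun t => wilsonAction4 (γ t)) 0 = 0) →
          ∃ u : GaugeTransf (F.P K) 0 (Matrix.specialUnitaryGroup (Fin 2) ℂ),
            W' = GaugeField.gaugeAct u W ∧ GaugeField.gaugeAct (descTransf F n K hnK.le u) V = V := by
  obtain ⟨e₈, c, he₈, hc, H⟩ := orbitGrowth_of_regular_five L h5
  refine ⟨e₈, he₈, ?_⟩
  intro F hF n K hnK e V W W' he heε hW hELW hW' hELW'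
  obtain ⟨u, hu⟩ := H F hF n K hnK e V W he heε hW hELW W' hW'
  obtain ⟨u', hu'⟩ := H F hF n K hnK e V W' he heε hW' hELW' W hW
  have hℓ : (0 : ℝ) < c * (((F.L : ℝ) ^ (K - n)) ^ 2)⁻¹ := by
    have hL : (0 : ℝ) < (F.L : ℝ) := by have := F.hL.2; exact_mod_cast (by omega : 0 < F.L)
    positivity
  have hS0 : 0 ≤ ∑ ℓ : PBond (F.P K) 0, dist1 (W' ℓ * ((GaugeField.gaugeAct u W) ℓ)⁻¹) ^ 2 := Finset.sum_nonneg fun _ _ => sq_nonneg _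
  have hS0' : 0 ≤ ∑ ℓ : PBond (F.P K) 0, dist1 (W ℓ * ((GaugeField.gaugeAct u' W') ℓ)⁻¹) ^ 2 := Finset.sum_nonneg fun _ _ => sq_nonneg _
  -- equal actions
  have hA : wilsonAction4 W' = wilsonAction4 W := by
    have h1 : 0 ≤ wilsonAction4 W' - wilsonAction4 W := (mul_nonneg hℓ.le hS0).trans hu
    have h2 : 0 ≤ wilsonAction4 W - wilsonAction4 W' := (mul_nonneg hℓ.le hS0').trans hu'
    linarith
  have hsum : ∑ ℓ : PBond (F.P K) 0, dist1 (W' ℓ * ((GaugeField.gaugeAct u W) ℓ)⁻¹) ^ 2 = 0 := by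
    have h1 : c * (((F.L : ℝ) ^ (K - n)) ^ 2)⁻¹ * ∑ ℓ : PBond (F.P K) 0, dist1 (W' ℓ * ((GaugeField.gaugeAct u W) ℓ)⁻¹) ^ 2 ≤ 0 := by
      rw [hA, sub_self] at hu; exact hu
    have h2 : ∑ ℓ : PBond (F.P K) 0, dist1 (W' ℓ * ((GaugeField.gaugeAct u W) ℓ)⁻¹) ^ 2 ≤ 0 := by
      by_contra hne
      push Not at hne
      have := mul_pos hℓ hne
      linarith
    exact le_antisymm h2 hS0
  have hrel := eq_of_sum_dist1_sq_eq_zero hsum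
  exact ⟨u, hrel, gaugeAct_descTransf_eq_of_mem_fibre hnK.le u ((mem_regFibrePr_iff F).mp hW).1 ((mem_regFibrePr_iff F).mp hW').1 hrel⟩

/-! ## §3 … and lie on one orbit of print's group (4) when the datum's symmetries lift -/

/-- ★★ **PRINT's (4)-ORBIT FROM AN E–L-CRITICAL POINT WITH LIFTING SYMMETRIES** (`L ≥ 5`, `0 < e ≤ e₈(L)`): if `W, W′ ∈ regFibrePr F n K e V` are E–L-critical along every
bondwise-differentiable fibre curve and every symmetry `s` of `V` is the descent of some `k` fixing `W`, then `SameOrbit W W′` — §2 gives `u` with `(u↓) • V = V`, the lift `k` of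
`u↓` fixes `W`, and `w := u·k⁻¹` has `w↓ ≡ 1`, `w • W = u • W = W′` (✓pen 4 §3b's algebra). [cite: Balaban1985Variational, Prop. 7 p.299, (4) p.278] -/
theorem sameOrbit_of_el_of_symmetriesLift_five (L : ℕ) (h5 : 5 ≤ L) :
    ∃ e₈ : ℝ, 0 < e₈ ∧
      ∀ (F : T3Family), F.L = L → ∀ (n K : ℕ) (hnK : n < K) (e : ℝ) (V : GaugeField (F.P n) 0 (Matrix.specialUnitaryGroup (Fin 2) ℂ))
        (W W' : GaugeField (F.P K) 0 (Matrix.specialUnitaryGroup (Fin 2) ℂ)),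
        0 < e → e ≤ e₈ → W ∈ regFibrePr F n K hnK.le e V →
        (∀ γ : ℝ → GaugeField (F.P K) 0 (Matrix.specialUnitaryGroup (Fin 2) ℂ), γ 0 = W → (∀ t, γ t ∈ fibre F ℰp n K hnK.le V) →
          (∀ b, DifferentiableAt ℝ (fun t => ((γ t b : Matrix.specialUnitaryGroup (Fin 2) ℂ) : Matrix (Fin 2) (Fin 2) ℂ)) 0) →
            deriv (fun t => wilsonAction4 (γ t)) 0 = 0) →
        (∀ s : GaugeTransf (F.P n) 0 (Matrix.specialUnitaryGroup (Fin 2) ℂ), GaugeField.gaugeAct s V = V →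
            ∃ k : GaugeTransf (F.P K) 0 (Matrix.specialUnitaryGroup (Fin 2) ℂ), GaugeField.gaugeAct k W = W ∧ descTransf F n K hnK.le k = s) →
        W' ∈ regFibrePr F n K hnK.le e V →
        (∀ γ : ℝ → GaugeField (F.P K) 0 (Matrix.specialUnitaryGroup (Fin 2) ℂ), γ 0 = W' → (∀ t, γ t ∈ fibre F ℰp n K hnK.le V) →
          (∀ b, DifferentiableAt ℝ (fun t => ((γ t b : Matrix.specialUnitaryGroup (Fin 2) ℂ) : Matrix (Fin 2) (Fin 2) ℂ)) 0) →
            deriv (fun t => wilsonAction4 (γ t)) 0 = 0) →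
          SameOrbit F n K hnK.le W W' := by
  obtain ⟨e₈, he₈, H⟩ := critical_gaugeRelated_of_el_five L h5
  refine ⟨e₈, he₈, ?_⟩
  intro F hF n K hnK e V W W' he heε hW hELW hlift hW' hELW'
  obtain ⟨u, hrel, hfix⟩ := H F hF n K hnK e V W W' he heε hW hELW hW' hELW'
  obtain ⟨k, hkW, hk⟩ := hlift (descTransf F n K hnK.le u) hfix
  refine ⟨fun x => u x * (k x)⁻¹, ?_, ?_⟩
  · rw [descTransf_mul_inv, hk]
    funext y
    exact mul_inv_cancel _
  · rw [hrel]
    funext b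
    have hkb : k b.src * W b * (k b.tgt)⁻¹ = W b := congrFun hkW b
    show u b.src * W b * (u b.tgt)⁻¹ = u b.src * (k b.src)⁻¹ * W b * (u b.tgt * (k b.tgt)⁻¹)⁻¹
    have hinv : (k b.src)⁻¹ * W b * k b.tgt = W b := by
      calc (k b.src)⁻¹ * W b * k b.tgt = (k b.src)⁻¹ * (k b.src * W b * (k b.tgt)⁻¹) * k b.tgt := by rw [hkb]
        _ = W b := by group
    calc u b.src * W b * (u b.tgt)⁻¹ = u b.src * ((k b.src)⁻¹ * W b * k b.tgt) * (u b.tgt)⁻¹ := by rw [hinv]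
      _ = u b.src * (k b.src)⁻¹ * W b * (u b.tgt * (k b.tgt)⁻¹)⁻¹ := by group

/-! ## §4 Prop. 7 clause 1 from ONE E–L-critical regular point with lifting symmetries -/

/-- ★★★ **[Balaban1985Variational] PROP. 7 CLAUSE 1 ⟸ «SOME (6)-REGULAR FIBRE POINT IS E–L-CRITICAL AND THE DATUM's SYMMETRIES LIFT TO IT»** (`L ≥ 5`, `0 < e ≤ e₈(L)`).  The witness
`W` need not be critical in reading R2 (Palais-critical points of px12's abelian stratum qualify) and need not be one of the two R2-critical points compared: each of those is
E–L-critical (✓`Prop7CritEL.deriv_comp_eq_zero_of_isCritR2`), §3 puts both on `W`'s (4)-orbit, and ✓`sameOrbit_symm`∕`sameOrbit_trans` conclude.  Covers ✓pen 4 (central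
stabiliser: `k := ±1`), the flat datum, and — modulo the abelian existence letter EX^{ab} — the abelian case-A data. [cite: Balaban1985Variational, Prop. 7 p.299, (4)-(6) p.278] -/
theorem atMostOneCriticalOrbit_of_el_symmetriesLift_five (L : ℕ) (h5 : 5 ≤ L) :
    ∃ e₈ : ℝ, 0 < e₈ ∧
      ∀ (F : T3Family), F.L = L → ∀ (n K : ℕ) (hnK : n < K) (e : ℝ) (V : GaugeField (F.P n) 0 (Matrix.specialUnitaryGroup (Fin 2) ℂ)),
        0 < e → e ≤ e₈ →
        (∃ W : GaugeField (F.P K) 0 (Matrix.specialUnitaryGroup (Fin 2) ℂ), W ∈ regFibrePr F n K hnK.le e V ∧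
          (∀ γ : ℝ → GaugeField (F.P K) 0 (Matrix.specialUnitaryGroup (Fin 2) ℂ), γ 0 = W → (∀ t, γ t ∈ fibre F ℰp n K hnK.le V) →
            (∀ b, DifferentiableAt ℝ (fun t => ((γ t b : Matrix.specialUnitaryGroup (Fin 2) ℂ) : Matrix (Fin 2) (Fin 2) ℂ)) 0) →
              deriv (fun t => wilsonAction4 (γ t)) 0 = 0) ∧
          (∀ s : GaugeTransf (F.P n) 0 (Matrix.specialUnitaryGroup (Fin 2) ℂ), GaugeField.gaugeAct s V = V →
            ∃ k : GaugeTransf (F.P K) 0 (Matrix.specialUnitaryGroup (Fin 2) ℂ), GaugeField.gaugeAct k W = W ∧ descTransf F n K hnK.le k = s)) →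
          (varProblem3 F n K hnK.le).AtMostOneCriticalOrbit e V := by
  obtain ⟨e₈, he₈, H⟩ := sameOrbit_of_el_of_symmetriesLift_five L h5
  refine ⟨e₈, he₈, ?_⟩
  intro F hF n K hnK e V he heε hex U U' hUreg hUfib hUcrit hU'reg hU'fib hU'crit
  obtain ⟨W, hW, hELW, hlift⟩ := hex
  have hU : U ∈ regFibrePr F n K hnK.le e V := (mem_regFibrePr_iff F).mpr ⟨hUfib, hUreg⟩
  have hU' : U' ∈ regFibrePr F n K hnK.le e V := (mem_regFibrePr_iff F).mpr ⟨hU'fib, hU'reg⟩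
  have hELU : ∀ γ : ℝ → GaugeField (F.P K) 0 (Matrix.specialUnitaryGroup (Fin 2) ℂ), γ 0 = U → (∀ t, γ t ∈ fibre F ℰp n K hnK.le V) →
      (∀ b, DifferentiableAt ℝ (fun t => ((γ t b : Matrix.specialUnitaryGroup (Fin 2) ℂ) : Matrix (Fin 2) (Fin 2) ℂ)) 0) →
        deriv (fun t => wilsonAction4 (γ t)) 0 = 0 :=
    fun γ hγ0 hγfib hγd => deriv_comp_eq_zero_of_isCritR2 hUcrit γ hγ0 hγfib (continuousAt_of_differentiableAt_bonds γ hγd)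
  have hELU' : ∀ γ : ℝ → GaugeField (F.P K) 0 (Matrix.specialUnitaryGroup (Fin 2) ℂ), γ 0 = U' → (∀ t, γ t ∈ fibre F ℰp n K hnK.le V) →
      (∀ b, DifferentiableAt ℝ (fun t => ((γ t b : Matrix.specialUnitaryGroup (Fin 2) ℂ) : Matrix (Fin 2) (Fin 2) ℂ)) 0) →
        deriv (fun t => wilsonAction4 (γ t)) 0 = 0 :=
    fun γ hγ0 hγfib hγd => deriv_comp_eq_zero_of_isCritR2 hU'crit γ hγ0 hγfib (continuousAt_of_differentiableAt_bonds γ hγd)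
  have h1 : SameOrbit F n K hnK.le W U := H F hF n K hnK e V W U he heε hW hELW hlift hU hELU
  have h2 : SameOrbit F n K hnK.le W U' := H F hF n K hnK e V W U' he heε hW hELW hlift hU' hELU'
  exact sameOrbit_trans F hnK.le (sameOrbit_symm F hnK.le h1) h2

end Summit.QuantumFields.YangMills.Theorems.FluctuationComparisonRegPrIntLS2BetaCriticalELRelated

end
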